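import Literature.NumberTheory.NumberFields.EquivariantIwasawaLemmaClassGroup
import HarnessLib

/-!
# The equivariant Iwasawa lemma, VIII: an equivariant inertia-trivial character takes
# DECOMPOSITION-INVARIANT values at Frobenius elements — PROVED

Topic `NumberTheory/NumberFields` (namespace = path, grouping sub-namespace `EquivariantIwasawaLemma`).
THEOREM-ONLY file (no definition, no named fact, no `sorry`), written by the literature seat
`bsd-potss-conjA-anchor` g17 (cell `bsd-potss`; serves the asides stmt-BirchSwinnertonDyer-19386 / 19413;
closes nothing).  It isolates the one new piece of mathematics needed for the `S`-version of the
equivariant Iwasawa lemma (door L6 with Deo–Ray–Sujatha's hypothesis (c2) AS PRINTED,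
`Hom_G(H′_L, E[p]) = 0`, in place of the full (c2*)₀ — see the cell memo conjA-anchor g17 §5):

* **`smul_apply_eq_of_isArithFrobAt`** — `k ⊆ B`, `k ⊆ F ⊆ E` number fields with `E/k` Galois and `F/k`,
  `B/k` normal, `Γ ↠ Gal(F/k)` via `π`, `V` a `Γ`-module, `χ : Gal(E/B) → V` additive, killing every inertia
  group `I(𝔔|B)`, and `Γ`-equivariant under `Gal(E/k)`-conjugation (the hypothesis shape of
  `inertiaTrivialHom_eq_zero_of_classGroupHom_eq_zero`).  If `g ∈ Gal(E/B)` is an arithmetic Frobenius at a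
  maximal ideal `𝔔` of `𝓞_E` (Mathlib `IsArithFrobAt`), then `τ • χ(g) = χ(g)` for every `τ ∈ Γ` whose image
  `π τ` stabilises the prime `𝔔 ∩ 𝓞_F` of `F`.  PROOF: lift `π τ` to `g̃ ∈ Gal(E/k)` with `g̃𝔔 = 𝔔` (any lift
  moves `𝔔` to a prime over the same prime of `F`; correct by `Gal(E/F)`, transitive on those primes —
  Mathlib `Ideal.exists_smul_eq_of_isGaloisGroup`); the conjugate `g̃ g g̃⁻¹ ∈ Gal(E/B)` is again an
  arithmetic Frobenius at `g̃𝔔 = 𝔔`, hence differs from `g` by an element of `I(𝔔|B)` (Mathlib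
  `IsArithFrobAt.mul_inv_mem_inertia`), which `χ` kills; and equivariance says `χ(g̃gg̃⁻¹) = τ • χ(g)`.
* Consequence (docstring only; the use is in the successor's `S`-version of file III): with hypothesis
  (c3*) «`V^{Stab_Γ(𝔓)} = 0`» at a prime `𝔓` of `F`, `χ` vanishes at every Frobenius element — hence on the
  whole decomposition group — of every prime of `E` above `𝔓`, so the class-group functional `μ : Cl(B) → V`
  that class field theory attaches to `χ` kills the classes of the primes of `B` below `𝔓`: the
  `S`-refinement `Hom_Γ(H′_{B,S}, V) = 0 ⟹ χ = 0` of `inertiaTrivialHom_eq_zero_of_classGroupHom_eq_zero`.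

## References

* J. Neukirch, *Algebraic Number Theory* (1999), Ch. I §9 Prop. (9.1), (9.4)–(9.6) (transitivity on primes,
  Frobenius and its conjugates). [NeukirchANT1999]
* J.-P. Serre, *Local Fields*, GTM 67 (1979), Ch. I §7 Prop. 22, §8 (Frobenius substitution). [SerreLocalFields1979]
* S. V. Deo, A. Ray, R. Sujatha, Pure Appl. Math. Q. 19 (2023), §3 Thm. 3.8 hypotheses (c2), (c3)
  (arXiv:2202.09937 p. 9). [DeoRaySujatha2023]
-/

noncomputable section

open scoped Pointwise
open NumberField Ideal

namespace Literature.NumberTheory.NumberFields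

namespace EquivariantIwasawaLemma

section Frobenius

variable {k B F E : Type} [Field k] [Field B] [Field F] [NumberField F] [Field E] [NumberField E]
  [Algebra k B] [Algebra k F] [Algebra k E] [Algebra B E] [Algebra F E]
  [IsScalarTower k B E] [IsScalarTower k F E] [IsGalois k E] [Normal k B] [Normal k F]

omit [NumberField F] [NumberField E] [Algebra k F] [Algebra F E] [IsScalarTower k F E] [IsGalois k E]
  [Normal k F] in
/-- `g̃⁻¹` moves `B` by `(g̃|_B)⁻¹`. [folklore] -/
private theorem symm_algebraMap'' (g : E ≃ₐ[k] E) (x : B) :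
    g.symm (algebraMap B E x) = algebraMap B E ((g.restrictNormal B).symm x) := by
  apply g.injective
  rw [AlgEquiv.apply_symm_apply, ← AlgEquiv.restrictNormal_commutes, AlgEquiv.apply_symm_apply]

omit [NumberField F] [NumberField E] [Algebra k F] [Algebra F E] [IsScalarTower k F E] [IsGalois k E]
  [Normal k F] in
/-- For `g̃ ∈ Aut(E/k)` and `σ ∈ Aut(E/B)` (`B/k` normal) the conjugate `g̃ σ g̃⁻¹` is `B`-linear.
[folklore] -/
private theorem exists_conj'' (g : E ≃ₐ[k] E) (σ : E ≃ₐ[B] E) :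
    ∃ σ' : E ≃ₐ[B] E, ∀ y, σ' y = g (σ (g.symm y)) := by
  refine ⟨AlgEquiv.ofRingEquiv (f := g.symm.toRingEquiv.trans (σ.toRingEquiv.trans g.toRingEquiv))
    fun x => ?_, fun y => rfl⟩
  change g (σ (g.symm (algebraMap B E x))) = algebraMap B E x
  rw [symm_algebraMap'', AlgEquiv.commutes, ← AlgEquiv.restrictNormal_commutes, AlgEquiv.apply_symm_apply]

omit [NumberField F] [NumberField E] [Algebra k B] [Algebra B E] [IsScalarTower k B E] [IsGalois k E]
  [Normal k B] in
/-- Restriction to `F` is compatible with the actions on `𝓞_F ⊆ 𝓞_E`. [folklore] -/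
private theorem algebraMap_restrictNormalHom_smul' (σ : E ≃ₐ[k] E) (y : 𝓞 F) :
    algebraMap (𝓞 F) (𝓞 E) (AlgEquiv.restrictNormalHom F σ • y) = σ • algebraMap (𝓞 F) (𝓞 E) y := by
  apply RingOfIntegers.coe_injective
  change algebraMap F E (σ.restrictNormal F (y : F)) = σ (algebraMap F E (y : F))
  exact σ.restrictNormal_commutes F (y : F)

omit [NumberField F] [NumberField E] [Algebra k B] [Algebra B E] [IsScalarTower k B E] [IsGalois k E]
  [Normal k B] in
/-- `(σ𝔔) ∩ 𝓞_F = σ|_F (𝔔 ∩ 𝓞_F)`. [cite: SerreLocalFields1979, Ch. I §7 (proof of Prop. 22)] -/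
private theorem under_smul_eq_restrictNormalHom_smul_under' (σ : E ≃ₐ[k] E) (𝔔 : Ideal (𝓞 E)) :
    (σ • 𝔔).under (𝓞 F) = AlgEquiv.restrictNormalHom F σ • 𝔔.under (𝓞 F) := by
  ext y
  rw [Ideal.mem_pointwise_smul_iff_inv_smul_mem, Ideal.under_def, Ideal.under_def, Ideal.mem_comap,
    Ideal.mem_comap, Ideal.mem_pointwise_smul_iff_inv_smul_mem, ← map_inv,
    algebraMap_restrictNormalHom_smul']

omit [NumberField F] [NumberField E] [Algebra k B] [Algebra B E] [IsScalarTower k B E] [IsGalois k E]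
  [Normal k B] in
/-- An `F`-automorphism restricts to the identity of `F`. [folklore] -/
private theorem restrictNormalHom_restrictScalars_eq_one (a : E ≃ₐ[F] E) :
    AlgEquiv.restrictNormalHom F (a.restrictScalars k) = 1 := by
  apply AlgEquiv.ext
  intro x
  apply (algebraMap F E).injective
  change algebraMap F E ((a.restrictScalars k).restrictNormal F x) = algebraMap F E x
  rw [AlgEquiv.restrictNormal_commutes, AlgEquiv.restrictScalars_apply, AlgEquiv.commutes]

omit [NumberField F] [NumberField E] [Algebra k B] [Algebra B E] [IsScalarTower k B E] [IsGalois k E]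
  [Normal k B] [Normal k F] in
/-- The ideal `a • 𝔔` does not depend on whether `a` is read as an `F`- or as a `k`-automorphism.
[folklore] -/
private theorem restrictScalars_smul_ideal (a : E ≃ₐ[F] E) (𝔔 : Ideal (𝓞 E)) :
    (a.restrictScalars k) • 𝔔 = a • 𝔔 := by
  ext x
  rw [Ideal.mem_pointwise_smul_iff_inv_smul_mem, Ideal.mem_pointwise_smul_iff_inv_smul_mem]
  have h : (a.restrictScalars k)⁻¹ • x = a⁻¹ • x := Subtype.ext rfl
  rw [h]

set_option maxHeartbeats 800000 in
/-- **The value of an equivariant inertia-trivial character at a Frobenius element is invariant under the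
decomposition group.**  `k ⊆ B`, `k ⊆ F ⊆ E` number fields, `E/k` Galois, `B/k` and `F/k` normal;
`π : Γ ↠ Gal(F/k)`, `V` a `Γ`-module; `χ : Gal(E/B) → V` additive, killing the inertia group in `Gal(E/B)`
of every maximal ideal of `𝓞_E`, and `Γ`-equivariant: `χ(g̃ a g̃⁻¹) = τ • χ(a)` whenever `g̃ ∈ Gal(E/k)`
restricts to `π τ` on `F`.  Then for an arithmetic Frobenius `g ∈ Gal(E/B)` at a maximal ideal `𝔔` of
`𝓞_E` and every `τ ∈ Γ` with `π τ • (𝔔 ∩ 𝓞_F) = 𝔔 ∩ 𝓞_F`: `τ • χ(g) = χ(g)`.  (Hence, under (c3*)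
«no non-zero vector of `V` is fixed by the stabiliser of `𝔔 ∩ 𝓞_F`», `χ(g) = 0`.)
[cite: NeukirchANT1999, Ch. I §9 Prop. (9.1) and (9.4)–(9.6)]
[cite: SerreLocalFields1979, Ch. I §7 Prop. 22 and §8] -/
theorem smul_apply_eq_of_isArithFrobAt
    {Γ : Type*} [Group Γ] (π : Γ →* (F ≃ₐ[k] F))
    {V : Type*} [AddCommGroup V] [DistribMulAction Γ V]
    (χ : (E ≃ₐ[B] E) → V) (hχadd : ∀ a b, χ (a * b) = χ a + χ b)
    (hχI : ∀ (Q : Ideal (𝓞 E)) [Q.IsMaximal], ∀ s ∈ Q.inertia (E ≃ₐ[B] E), χ s = 0)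
    (hχequiv : ∀ (τ : Γ) (g : E ≃ₐ[k] E) (a a' : E ≃ₐ[B] E),
      AlgEquiv.restrictNormalHom F g = π τ → (∀ y, a' y = g (a (g.symm y))) → χ a' = τ • χ a)
    (𝔔 : Ideal (𝓞 E)) [h𝔔 : 𝔔.IsMaximal] (g : E ≃ₐ[B] E) (hg : IsArithFrobAt (𝓞 B) g 𝔔)
    (τ : Γ) (hτ : π τ • 𝔔.under (𝓞 F) = 𝔔.under (𝓞 F)) :
    τ • χ g = χ g := by
  classical
  haveI : CharZero k := (algebraMap k E).charZero
  haveI : FiniteDimensional k E := Module.Finite.of_restrictScalars_finite ℚ k E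
  haveI : FiniteDimensional F E := Module.Finite.of_restrictScalars_finite ℚ F E
  haveI : IsGalois F E := IsGalois.tower_top_of_isGalois k F E
  -- ### a lift `g̃` of `π τ` fixing `𝔔`
  obtain ⟨g₀, hg₀⟩ := AlgEquiv.restrictNormalHom_surjective E (π τ)
  set P : Ideal (𝓞 F) := 𝔔.under (𝓞 F) with hPdef
  haveI : (g₀ • 𝔔).IsPrime := Ideal.IsPrime.smul _
  haveI hQ₁P : (g₀ • 𝔔).LiesOver P := ⟨by
    rw [under_smul_eq_restrictNormalHom_smul_under', hg₀, ← hPdef, hτ]⟩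
  haveI : 𝔔.LiesOver P := ⟨rfl⟩
  haveI : IsGaloisGroup (E ≃ₐ[F] E) (𝓞 F) (𝓞 E) :=
    IsGaloisGroup.of_isFractionRing (E ≃ₐ[F] E) (𝓞 F) (𝓞 E) F E
  obtain ⟨a, ha⟩ := Ideal.exists_smul_eq_of_isGaloisGroup P (g₀ • 𝔔) 𝔔 (E ≃ₐ[F] E)
  set g₁ : E ≃ₐ[k] E := a.restrictScalars k * g₀ with hg₁def
  have hg₁F : AlgEquiv.restrictNormalHom F g₁ = π τ := by
    rw [hg₁def, map_mul, restrictNormalHom_restrictScalars_eq_one, one_mul, hg₀]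
  have hg₁𝔔 : g₁ • 𝔔 = 𝔔 := by
    rw [hg₁def, mul_smul, restrictScalars_smul_ideal, ha]
  -- ### the conjugate `a' = g̃ g g̃⁻¹` is an arithmetic Frobenius at `𝔔`
  obtain ⟨a', ha'⟩ := exists_conj'' g₁ g
  have ha'smul : ∀ x : 𝓞 E, a' • x = g₁ • (g • (g₁⁻¹ • x)) := fun x => Subtype.ext (ha' x)
  have hgx : ∀ x : 𝓞 E, g • x - x ^ Nat.card (𝓞 B ⧸ 𝔔.under (𝓞 B)) ∈ 𝔔 := hg
  have ha'frob : IsArithFrobAt (𝓞 B) a' 𝔔 := by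
    intro x
    rw [MulSemiringAction.toAlgHom_apply, ha'smul]
    have h1 := hgx (g₁⁻¹ • x)
    have h2 : g₁ • (g • (g₁⁻¹ • x) - (g₁⁻¹ • x) ^ Nat.card (𝓞 B ⧸ 𝔔.under (𝓞 B))) ∈ g₁ • 𝔔 :=
      Ideal.smul_mem_pointwise_smul_iff.mpr h1
    rwa [smul_sub, smul_pow', smul_inv_smul, hg₁𝔔] at h2
  -- ### `a' g⁻¹ ∈ I(𝔔|B)`, so `χ a' = χ g`; and `χ a' = τ • χ g`
  have hI : a' * g⁻¹ ∈ 𝔔.inertia (E ≃ₐ[B] E) := IsArithFrobAt.mul_inv_mem_inertia ha'frob hg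
  have h1 : χ a' = χ g := by
    have e1 : a' = a' * g⁻¹ * g := by rw [inv_mul_cancel_right]
    rw [e1, hχadd, hχI 𝔔 _ hI, zero_add]
  rw [← hχequiv τ g₁ g a' hg₁F ha', h1]

/-- **Corollary: under (c3*) the character vanishes at Frobenius elements.**  In the situation of
`smul_apply_eq_of_isArithFrobAt`, if no non-zero vector of `V` is fixed by all `τ ∈ Γ` with
`π τ • (𝔔 ∩ 𝓞_F) = 𝔔 ∩ 𝓞_F` (hypothesis (c3*) of the equivariant Iwasawa lemma at the prime `𝔔 ∩ 𝓞_F`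
of `F`), then `χ(g) = 0` for every arithmetic Frobenius `g ∈ Gal(E/B)` at `𝔔`.
[cite: NeukirchANT1999, Ch. I §9 (9.4)–(9.6)]
[cite: DeoRaySujatha2023, §3 Thm. 3.8 hypothesis (c3) (arXiv:2202.09937 p. 9)] -/
theorem apply_eq_zero_of_isArithFrobAt
    {Γ : Type*} [Group Γ] (π : Γ →* (F ≃ₐ[k] F))
    {V : Type*} [AddCommGroup V] [DistribMulAction Γ V]
    (χ : (E ≃ₐ[B] E) → V) (hχadd : ∀ a b, χ (a * b) = χ a + χ b)
    (hχI : ∀ (Q : Ideal (𝓞 E)) [Q.IsMaximal], ∀ s ∈ Q.inertia (E ≃ₐ[B] E), χ s = 0)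
    (hχequiv : ∀ (τ : Γ) (g : E ≃ₐ[k] E) (a a' : E ≃ₐ[B] E),
      AlgEquiv.restrictNormalHom F g = π τ → (∀ y, a' y = g (a (g.symm y))) → χ a' = τ • χ a)
    (𝔔 : Ideal (𝓞 E)) [𝔔.IsMaximal]
    (hD : ∀ v : V, (∀ τ : Γ, π τ • 𝔔.under (𝓞 F) = 𝔔.under (𝓞 F) → τ • v = v) → v = 0)
    (g : E ≃ₐ[B] E) (hg : IsArithFrobAt (𝓞 B) g 𝔔) : χ g = 0 :=
  hD (χ g) fun τ hτ => smul_apply_eq_of_isArithFrobAt π χ hχadd hχI hχequiv 𝔔 g hg τ hτ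

end Frobenius

end EquivariantIwasawaLemma

end Literature.NumberTheory.NumberFields

end
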